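import Summits.NavierStokesRegularity.NavierStokesRegularity.Theorems.ScenarioCensusRowF1ax
import Summits.NavierStokesRegularity.NavierStokesRegularity.Theorems.TypeICertificateLadderRungZero
import Literature.Analysis.FluidPDE.BarkerPrange2020VorticityAlignmentTypeIHolds
import Literature.Analysis.FluidPDE.TypeIAncientMildTimeAnalytic
import Literature.Analysis.FluidPDE.TypeIAncientMildRescale
import Summits.NavierStokesRegularity.NavierStokesRegularity.Theorems.LocalHelicityTubeDoorFrobeniusProfileRigidityHelicalSlice
import HarnessLib
import Summits.NavierStokesRegularity.NavierStokesRegularity.Theorems.ExtremiserTransienceNearExtremalTransiencePerFlowAxisymmetricTypeILiouville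
import Summits.NavierStokesRegularity.NavierStokesRegularity.Theorems.ScenarioCensusRowF1ScrewTopRows
import Summits.NavierStokesRegularity.NavierStokesRegularity.Theorems.ScenarioCensusRotationOrder
import Summits.NavierStokesRegularity.NavierStokesRegularity.Theorems.RellichScarSymmetricScarExistsIrrationalStabiliser

/-!
# Census row F1, the POINT-GROUP / LAGGED-ISOMETRY axis — WHIRL pockets over an angle set and PRECESSION pockets read at SNAPSHOTS (cells F1gx / F1wx / F1qx / F1px; floors WF / PF) — LINE 42
# «whirl-top» port, part 1/4: §1 objects (frame of LINES 34–41 BY NAME; `WhirlPocketAt`, `PrecessionPocketAt`, `GeneratesAngles`, floors, rows); §2–§3 compactness, socket, Leray's every-time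
# floor and the witness zoom package (LINES 37 / 39 BY NAME); §4a rotations / screw frame (LINE 41 BY NAME), ANGLE GENERATION (an interval: Archimedes `forall_of_interval`; one irrational turn:
# the closed-subgroup dichotomy BY NAME), `whirl_all_angles`

Re-homed for the scenario census (typer seat ns-census-typer-1 g10; the cells F1gx / F1wx / F1qx / F1px and the floors WF / PF are members of row F1 «DECIDED IN KERNEL IN FILES» (LINE 42:
ref ns-census-ref g15 PRE-CHECK ✓ §20.19, critic idea-crit-3 g10 PASS no price tier B 14:05:49Z, lead booking CANDIDATE 3/4 at v1.124 → of record with the critic's PASS); this port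
makes them TREE-decided): VERBATIM PORT of ns-idea-3 LINE 42 «whirl-top», `pub/ideators/ns-idea-3/lines/whirl-top/line-whirl-top.lean` sha16 b777a0715a2eb784 (1320 l., lean check rc 0,
0 sorry), split for the 400-line rule into `ScenarioCensusRowF1WhirlTop` (§1–§4a) → `…WhirlTopKill` (§4b) → `…WhirlTopFloors` (§5) → `…WhirlTopRows` (§6–§7 + census KEYS).  Lean text
VERBATIM in namespace `…Theorems.ScenarioCensus.WhirlTop` (the line's `…Cruxes.ScenarioCensusRowF1.WhirlTopLine` re-homed); port edits: the frame restated VERBATIM by the line from LINES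
34–41 (`topSet`, `HasTypeIConstant`, `snapLevel`, `exists_fast_at`, `sqrt_mul_sq_mul`, `limitClass_compact`, `exists_level_of_limitKill`, `exists_witnessZoom_package`, `zoom_units`,
`eventually_forall_not_of_not_frequently`, `continuous_slice'`, `tendsto_eval`, `le_of_units`, `row_of_floor`, `rotLin`, `rotCLM`, `coe_rotCLM`, `analyticAt_rotZ`, `analyticAt_transport`, `rotZ_smul_eZ'`, `stream_fast`)
is taken BY NAME from the landed two-time-top / one-level-top / snapshot-top / needle-top / echo-top / scaling-top / screw-top ports; elementary lemmas the line restates are the tree's BY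
NAME (`rotZ_add_vec'` = `ScrewBlowdown.rotZ_add_vec`, `rotZ_add_smul_eZ'` = `ScrewBlowdown.rotZ_add_smul_eZ`, `rotZ_smul_vec'` = `rotZ_smul`, `rotZ_neg_rotZ'` = `rotZ_neg_apply_rotZ`,
`continuous_rotZ`, `continuous_rotZ_angle'` = `continuous_rotZ_angle`, `centre_mem` = `IsTypeIAncientMild.comp_add_right` (Literature.Analysis.FluidPDE), `rotZ_two_pi'` =
`RotationOrder.rotZ_two_pi` (census rotation-order port), `addSubgroup_eq_univ_of_irrational_angle` / `forall_of_irrational_angle` = `SymmetricScarExists.RdssSplit.NearIdentity.…` — the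
line's own header names the latter two as clones); `analyticAt_linIso` and `tendstoLocallyUniformly_comp_of_tendsto` (twins of lemmas in route-cone modules that are not imported) are not
re-declared — the former's one-line proof term is inlined; `@[conjecture]` on the residual `WhirlCollapse` (≡ `ScenarioCensus.Row_F1`, OPEN); one-line docstrings added where missing (gate
lint).  Statements untouched.

No census VALUE is moved here (row F1 stays OPEN-WITH-LINE; the members become TREE-decided by name); NS regularity is NOT proved; `Row_F1` is untouched (zero
movement, `whirlCollapse_iff_rowF1`); no summit statement is proved by this file. Lemmas that restate already-landed tree declarations are taken BY NAME (gate lint `dedup.landed`): `topSet` = `TwoTimeTop.topSet`, `HasTypeIConstant` = `OneLevelTop.HasTypeIConstant`, `snapLevel` = `SnapshotTop.snapLevel`, `exists_fast_at` = `SnapshotTop.exists_fast_at`, `sqrt_mul_sq_mul` = `SnapshotTop.sqrt_mul_sq_mul`, `limitClass_compact` = `NeedleTop.limitClass_compact`, `exists_level_of_limitKill` = `NeedleTop.exists_level_of_limitKill`, `zoom_units` = `NeedleTop.zoom_units`, `exists_witnessZoom_package` = `EchoTop.exists_witnessZoom_package`, `eventually_forall_not_of_not_frequently` = `EchoTop.eventually_forall_not_of_not_frequently`,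 `centre_mem` = `IsTypeIAncientMild.comp_add_right`, `continuous_slice'` = `ScalingTop.continuous_slice'`, `tendsto_eval` = `ScalingTop.tendsto_eval`, `le_of_units` = `ScalingTop.le_of_units`, `rotZ_add_vec'` = `ScrewBlowdown.rotZ_add_vec`, `rotZ_smul_vec'` = `rotZ_smul`, `rotZ_add_smul_eZ'` = `ScrewBlowdown.rotZ_add_smul_eZ`, `rotLin` = `ScrewTop.rotLin`, `rotCLM` = `ScrewTop.rotCLM`, `analyticAt_rotZ` = `ScrewTop.analyticAt_rotZ`, `rotZ_neg_rotZ'` = `rotZ_neg_apply_rotZ`, `rotZ_two_pi'` = `RotationOrder.rotZ_two_pi`, `continuous_rotZ_angle'` = `continuous_rotZ_angle`, `addSubgroup_eq_univ_of_irrational_angle` = `SymmetricScarExists.RdssSplit.NearIdentity.addSubgroup_eq_top_of_irrational_angle`, `forall_of_irrational_angle` = `SymmetricScarExists.RdssSplit.NearIdentity.forall_of_irrational_angle_stabiliser`, `analyticAt_transport` = `ScrewTop.analyticAt_transport`, `rotZ_smul_eZ'` = `ScrewTop.rotZ_smul_eZ'`, `row_of_floor` = `ScalingTop.row_of_floor`,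 `stream_fast` = `ScrewTop.stream_fast`.
-/

-- the summit and its single problem share the name `NavierStokesRegularity` (D-0017 nested layout)
set_option linter.dupNamespace false

noncomputable section

open MeasureTheory Set Function Filter TopologicalSpace Metric
open scoped Topology NNReal ENNReal InnerProductSpace

namespace Summit.NavierStokesRegularity.NavierStokesRegularity.Theorems.ScenarioCensus.WhirlTop

open Literature.Analysis Literature.Analysis.FluidPDE
open Summit.NavierStokesRegularity.NavierStokesRegularity.Theorems
open Summit.NavierStokesRegularity.NavierStokesRegularity.Theses
open Summit.NavierStokesRegularity.NavierStokesRegularity.Theorems.LocalHelicityTubeDoorFrobeniusProfileRigidityHelicalSlice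
open Summit.NavierStokesRegularity.NavierStokesRegularity.Theorems.NearExtremalTransiencePerFlow.FilamentSelection
open Summit.NavierStokesRegularity.NavierStokesRegularity.Theorems.LocalSineTubeDoorProfileAlignedWindowRigidityAncient

/-- `ℝ³`. -/
abbrev E3 := EuclideanSpace ℝ (Fin 3)

/-! ## §1 Objects: top, dimensionless Type-I constant, Leray's level `c_S` (frame, verbatim); the read-outs (a WHIRL pocket over an angle
SET; a PRECESSION pocket for one lagged isometry); generating angle sets; floors, rows -/

-- `topSet`: the line restates the tree's `TwoTimeTop.topSet`; taken BY NAME (gate lint dedup.landed).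

-- `HasTypeIConstant`: the line restates the tree's `OneLevelTop.HasTypeIConstant`; taken BY NAME (gate lint dedup.landed).

-- `snapLevel`: the line restates the tree's `SnapshotTop.snapLevel`; taken BY NAME (gate lint dedup.landed).

/-- **A WHIRL POCKET at the instant `t` about the point `x`** (frame `L` — a linear isometry of `ℝ³` carrying the `x₂`-axis to the
direction of the whirl axis —, ANGLE SET `Θ ⊆ ℝ`, apex reach `A`, radius `a`, threshold `ε`; parabolic unit `ℓ = √(ν(T − t))`, speed unit
`√ν/√(T − t)`): there is an APEX `x_* = x + ℓ b`, `‖b‖ ≤ A`, such that on the pocket of radius `a ℓ` about `x_*` the SNAPSHOT at the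
instant `t` is — to dimensionless accuracy `ε` — EQUIVARIANT UNDER THE ROTATIONS about the axis `x_* + ℓ L(ℝ e₂)` through EVERY angle
`θ ∈ Θ`:  `√(T − t) ‖L⁻¹ u(t, x_* + ℓ L(R_θ w)) − R_θ L⁻¹ u(t, x_* + ℓ L w)‖ ≤ ε √ν` for `‖w‖ ≤ a` (`R_θ = rotZ θ`, KNSS's rotation
about the `x₂`-axis).  With `Θ` an interval this is LINE 41's helical pocket AT PITCH `0` — an AXISYMMETRIC-WITH-SWIRL pocket —, the cell
LINE 41 declined.  NOTHING is asked to be small, slow or swirl-free: every snapshot that is exactly axisymmetric about the axis in the frame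
`L` — a uniform stream along the axis, a SWIRLING COLUMN WITH AN AXIAL JET `w ↦ α J w + β e₂` (`J = rotGen`, rigid rotation + jet:
`swirlColumn_isAxisymmetric`), a Burgers- or Rankine-type vortex — satisfies it with `ε = 0` (`whirlPocketAt_of_isAxisymmetric`), at ANY
speed.  The cells of this line: `Θ ⊇ [θ₁, θ₂]` with `θ₁ < θ₂` (WX: a continuum of angles) and `Θ ∋ θ₀` with `θ₀/2π ∉ ℚ` (QX: ONE rotation
of infinite order); in general any `Θ` which, together with the full turn `2π`, GENERATES the angles (`GeneratesAngles Θ`).  A single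
RATIONAL angle `2πp/q` (a `q`-fold symmetry of the snapshot) is NOT a cell: the limit slice is merely `ℤ/q`-symmetric and no kill is known. -/
def WhirlPocketAt (ν T : ℝ) (u : ℝ → E3 → E3) (L : E3 ≃ₗᵢ[ℝ] E3) (Θ : Set ℝ) (A a ε t : ℝ) (x : E3) : Prop :=
  ∃ b : E3, ‖b‖ ≤ A ∧ ∀ θ ∈ Θ, ∀ w : E3, ‖w‖ ≤ a →
    Real.sqrt (T - t) * ‖L.symm (u t (x + (Real.sqrt (ν * (T - t))) • (b + L (rotZ θ w))))
      - rotZ θ (L.symm (u t (x + (Real.sqrt (ν * (T - t))) • (b + L w))))‖ ≤ ε * Real.sqrt ν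

/-- **`Θ` GENERATES THE ANGLES** (predicate form of «the closed subgroup of `ℝ` generated by `Θ ∪ {2π}` is `ℝ`»): every property of
angles that holds at `0`, is stable under sums and negatives, defines a CLOSED set, holds at the full turn `2π` and on `Θ`, holds at
every angle.  Inhabited by every set containing a non-degenerate interval (`generatesAngles_Icc`: Archimedes — LINE 41's group generation,
closedness unused) and by every set containing ONE angle `θ₀` with `θ₀/2π` irrational (`generatesAngles_singleton`: a closed subgroup of
`ℝ` is cyclic or everything, `AddSubgroup.dense_or_cyclic`; `SymmetricScarExists.RdssSplit.NearIdentity.forall_of_irrational_angle_stabiliser`, a clone of the tree's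
`forall_of_irrational_angle_stabiliser`); NOT by `{2πp/q}`. -/
def GeneratesAngles (Θ : Set ℝ) : Prop :=
  ∀ P : ℝ → Prop, P 0 → (∀ φ ψ : ℝ, P φ → P ψ → P (φ + ψ)) → (∀ φ : ℝ, P φ → P (-φ)) →
    IsClosed {φ : ℝ | P φ} → P (2 * Real.pi) → (∀ θ ∈ Θ, P θ) → ∀ φ : ℝ, P φ

/-- **A PRECESSION POCKET at the instant `t` about the point `x`** for ONE linear isometry `L` of `ℝ³`, an offset `d` and a LAG `θ`
(apex reach `A`, radius `a`, threshold `ε`): there is an apex `x_* = x + ℓ b`, `‖b‖ ≤ A`, such that on the pocket of radius `a ℓ` about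
`x_*` the snapshot at the instant `t` is, to accuracy `ε`, the image under the rigid motion `w ↦ L w + d` (apex coordinates, parabolic
units OF THE INSTANT `t`) of the snapshot at the EARLIER instant `t' = t − θ(T − t)`:
`√(T − t) ‖u(t, x_* + ℓ(L w + d)) − L u(t', x_* + ℓ w)‖ ≤ ε √ν` for `‖w‖ ≤ a`.  Cells: EVERY `L` — a rotation by ANY angle (`2π/q`
included), a REFLECTION, a rotary reflection — with ANY offset `d` (zero included), for every lag `θ > 0`: between the two instants the top
PRECESSES (turns rigidly about a nearby axis), is MIRRORED, or glides.  (`L = 1` is LINE 39's echo — a corner of this table, not new.)  What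
makes EVERY point-group element a cell once lagged — while at ONE instant a `q`-fold or mirror symmetry of the snapshot is no cell of this
line — is that in the limit class the relation transports the Type-I envelope from the slice `−1 − θ` to the slice `−1`, isometrically
(`eq_zero_of_precession`). -/
def PrecessionPocketAt (ν T : ℝ) (u : ℝ → E3 → E3) (L : E3 ≃ₗᵢ[ℝ] E3) (d : E3) (θ A a ε t : ℝ) (x : E3) : Prop :=
  ∃ b : E3, ‖b‖ ≤ A ∧ ∀ w : E3, ‖w‖ ≤ a →
    Real.sqrt (T - t) * ‖u t (x + (Real.sqrt (ν * (T - t))) • (b + (L w + d)))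
      - L (u (t - θ * (T - t)) (x + (Real.sqrt (ν * (T - t))) • (b + w)))‖ ≤ ε * Real.sqrt ν

/-- **THE WHIRL FLOOR** (structural theorem for EVERY Clay solution with a dimensionless Type-I constant `M`; PROVED, `whirlFloor_holds`):
for every level `Λ > 0`, frame `L`, generating angle set `Θ`, reach `A` and radius `a > 0` there is `ε = ε(M, Λ, L, Θ, A, a) > 0` such
that, for all instants `t < T` close enough to `T`, NO `Λ`-fast point has an `ε`-whirl pocket with these parameters — in words: late fast
points of a Type-I Clay solution are NEVER the seat of an approximately axisymmetric-with-swirl parabolic pocket (over a range of angles, or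
under one irrational turn).  No maximality / blow-up hypothesis; the quantifier over fast points is UNIVERSAL. -/
def WhirlFloor : Prop :=
  ∀ (M Λ : ℝ) (L : E3 ≃ₗᵢ[ℝ] E3) (Θ : Set ℝ) (A a : ℝ), 0 < Λ → GeneratesAngles Θ → 0 < a → ∃ ε : ℝ, 0 < ε ∧
    ∀ (ν T : ℝ), 0 < ν → 0 < T → ∀ (u : ℝ → E3 → E3) (p : ℝ → E3 → ℝ),
    IsClassicalNSSolutionOn (Ico 0 T) ν 0 u p → IsLerayHopfOn T ν 0 (u 0) u →
    HasRapidSpatialDecay (u 0) → OneLevelTop.HasTypeIConstant ν T M u →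
    ∀ᶠ t in 𝓝[<] T, ∀ x ∈ TwoTimeTop.topSet ν T u Λ t, ¬ WhirlPocketAt ν T u L Θ A a ε t x

/-- **THE PRECESSION FLOOR** (PROVED, `precessionFloor_holds`): for every level `Λ > 0`, linear isometry `L`, offset `d`, lag `θ > 0`,
reach `A` and radius `a > 0` there is `ε > 0` such that eventually NO `Λ`-fast point has an `ε`-precession pocket for `(L, d, θ)`. -/
def PrecessionFloor : Prop :=
  ∀ (M Λ : ℝ) (L : E3 ≃ₗᵢ[ℝ] E3) (d : E3) (θ A a : ℝ), 0 < Λ → 0 < θ → 0 < a → ∃ ε : ℝ, 0 < ε ∧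
    ∀ (ν T : ℝ), 0 < ν → 0 < T → ∀ (u : ℝ → E3 → E3) (p : ℝ → E3 → ℝ),
    IsClassicalNSSolutionOn (Ico 0 T) ν 0 u p → IsLerayHopfOn T ν 0 (u 0) u →
    HasRapidSpatialDecay (u 0) → OneLevelTop.HasTypeIConstant ν T M u →
    ∀ᶠ t in 𝓝[<] T, ∀ x ∈ TwoTimeTop.topSet ν T u Λ t, ¬ PrecessionPocketAt ν T u L d θ A a ε t x

/-- **ROW F1gx «WHIRL POCKETS, GENERATING ANGLE SET»** (Type I · no symmetry · Clay class; census shape; PROVED, `rowF1gx_holds`, a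
corollary of the floor at Leray's level `c_S`): for every `M`, frame `L`, generating `Θ`, reach `A`, radius `a > 0` there is `ε > 0` such
that: if along SOME sequence of instants `t_k ↑ T` every `c_S`-fast point has an `ε`-whirl pocket, the solution extends smoothly past `T`. -/
def Row_F1gx : Prop :=
  ∀ (M : ℝ) (L : E3 ≃ₗᵢ[ℝ] E3) (Θ : Set ℝ) (A a : ℝ), GeneratesAngles Θ → 0 < a → ∃ ε : ℝ, 0 < ε ∧
    ∀ (ν T : ℝ), 0 < ν → 0 < T → ∀ (u : ℝ → E3 → E3) (p : ℝ → E3 → ℝ),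
    IsClassicalNSSolutionOn (Ico 0 T) ν 0 u p → IsLerayHopfOn T ν 0 (u 0) u →
    HasRapidSpatialDecay (u 0) → OneLevelTop.HasTypeIConstant ν T M u →
    (∃ᶠ t in 𝓝[<] T, ∀ x ∈ TwoTimeTop.topSet ν T u SnapshotTop.snapLevel t, WhirlPocketAt ν T u L Θ A a ε t x) →
    HasSmoothExtensionPast ν 0 u T

/-- **ROW F1wx «WHIRL POCKETS OVER A RANGE OF ANGLES»** (= LINE 41's declined pitch-`0` cell; PROVED, `rowF1wx_holds`): frame `L`, angle
range `θ₁ < θ₂`, reach `A`, radius `a > 0`. -/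
def Row_F1wx : Prop :=
  ∀ (M : ℝ) (L : E3 ≃ₗᵢ[ℝ] E3) (θ₁ θ₂ A a : ℝ), θ₁ < θ₂ → 0 < a → ∃ ε : ℝ, 0 < ε ∧
    ∀ (ν T : ℝ), 0 < ν → 0 < T → ∀ (u : ℝ → E3 → E3) (p : ℝ → E3 → ℝ),
    IsClassicalNSSolutionOn (Ico 0 T) ν 0 u p → IsLerayHopfOn T ν 0 (u 0) u →
    HasRapidSpatialDecay (u 0) → OneLevelTop.HasTypeIConstant ν T M u →
    (∃ᶠ t in 𝓝[<] T, ∀ x ∈ TwoTimeTop.topSet ν T u SnapshotTop.snapLevel t, WhirlPocketAt ν T u L (Icc θ₁ θ₂) A a ε t x) →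
    HasSmoothExtensionPast ν 0 u T

/-- **ROW F1qx «ONE IRRATIONAL TURN»** (PROVED, `rowF1qx_holds`): frame `L`, ONE angle `θ₀` with `θ₀/2π` irrational, reach `A`, radius
`a > 0` — the snapshot nearly invariant under the single rotation `R_{θ₀}` about a nearby axis at every fast point. -/
def Row_F1qx : Prop :=
  ∀ (M : ℝ) (L : E3 ≃ₗᵢ[ℝ] E3) (θ₀ A a : ℝ), Irrational (θ₀ / (2 * Real.pi)) → 0 < a → ∃ ε : ℝ, 0 < ε ∧
    ∀ (ν T : ℝ), 0 < ν → 0 < T → ∀ (u : ℝ → E3 → E3) (p : ℝ → E3 → ℝ),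
    IsClassicalNSSolutionOn (Ico 0 T) ν 0 u p → IsLerayHopfOn T ν 0 (u 0) u →
    HasRapidSpatialDecay (u 0) → OneLevelTop.HasTypeIConstant ν T M u →
    (∃ᶠ t in 𝓝[<] T, ∀ x ∈ TwoTimeTop.topSet ν T u SnapshotTop.snapLevel t, WhirlPocketAt ν T u L {θ₀} A a ε t x) →
    HasSmoothExtensionPast ν 0 u T

/-- **ROW F1px «PRECESSION POCKETS»** (PROVED, `rowF1px_holds`): ANY linear isometry `L`, ANY offset `d`, lag `θ > 0`, reach `A`, radius
`a > 0`. -/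
def Row_F1px : Prop :=
  ∀ (M : ℝ) (L : E3 ≃ₗᵢ[ℝ] E3) (d : E3) (θ A a : ℝ), 0 < θ → 0 < a → ∃ ε : ℝ, 0 < ε ∧
    ∀ (ν T : ℝ), 0 < ν → 0 < T → ∀ (u : ℝ → E3 → E3) (p : ℝ → E3 → ℝ),
    IsClassicalNSSolutionOn (Ico 0 T) ν 0 u p → IsLerayHopfOn T ν 0 (u 0) u →
    HasRapidSpatialDecay (u 0) → OneLevelTop.HasTypeIConstant ν T M u →
    (∃ᶠ t in 𝓝[<] T, ∀ x ∈ TwoTimeTop.topSet ν T u SnapshotTop.snapLevel t, PrecessionPocketAt ν T u L d θ A a ε t x) →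
    HasSmoothExtensionPast ν 0 u T

/-! ## §2 COMPACTNESS of `𝒦_M` (values pointwise AND locally uniformly on slices, gradients pointwise) and the SOCKET LEMMA

`𝒦_M` = `IsTypeIAncientMild M`.  The tree's extraction theorem `exists_tendsto_of_typeI_seq_Ioo` (KNSS 2009, Lemma 6.1) fed with
MEMBERS of `𝒦_M` is the sequential compactness of `𝒦_M` (values pointwise and locally uniformly on slices, gradients pointwise;
LINES 36–39 VERBATIM).  A SCALING read-out is evaluated at points `b_j + λ•w` that MOVE with the apex `b_j` of the zoom, so this line
uses the LOCALLY UNIFORM clause (as LINE 38 did for its moving stars): after a further compactness step on the apex, a locally uniformly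
convergent sequence of slices is evaluated along convergent sequences of points (`TendstoLocallyUniformly.tendsto_comp`). -/

-- `limitClass_compact`: the line restates the tree's `NeedleTop.limitClass_compact`; taken BY NAME (gate lint dedup.landed).

-- `tendstoLocallyUniformly_comp_of_tendsto`: a statement-twin of the landed `AdaptedFrequencyTangentFlowTransfer.tendstoLocallyUniformly_comp_of_tendsto` (route-cone module, NOT imported); not re-declared — unused below (LINE 40's `tendsto_eval` is taken BY NAME).

-- `exists_level_of_limitKill`: the line restates the tree's `NeedleTop.exists_level_of_limitKill`; taken BY NAME (gate lint dedup.landed).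

/-! ## §3 Leray's EVERY-TIME floor (for the census rows) and the WITNESS ZOOM PACKAGE (LINE 39 VERBATIM: zooms centred at GIVEN fast points)

LINES 36–38 centred their zooms at `c_S`-fast points supplied by Leray's every-time lower rate under NON-extension (`SnapshotTop.exists_fast_at`,
kept here for the census-shaped rows).  THE WITNESS PACKAGE below instead takes the centres FROM THE HYPOTHESIS: if frequently as
`t ↑ T` there is a `Λ`-fast point `x` with a property `Q t x`, the zooms centred at such `(t_j, x_j)` converge in `𝒦_M` (SAME `M`) to a
limit with `‖W(−1, 0)‖ ≥ Λ` — for ANY level `Λ`, with NO maximality hypothesis (the Type-I window alone runs the tree's zoom lemmas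
`zoom_continuousOn` / `zoom_isWeaklyDivFree` / `zoom_oseen` / `zoom_norm_le` and the extraction `exists_tendsto_of_typeI_seq_Ioo`).
This is what makes the floors UNIVERSAL over fast points (every `Λ`-fast point fails the scaling read-out), where LINES 36–38 could
only say that SOME `c_S`-fast point fails to be calm. -/

-- `exists_fast_at`: the line restates the tree's `SnapshotTop.exists_fast_at`; taken BY NAME (gate lint dedup.landed).

-- `sqrt_mul_sq_mul`: the line restates the tree's `SnapshotTop.sqrt_mul_sq_mul`; taken BY NAME (gate lint dedup.landed).

-- `exists_witnessZoom_package`: the line restates the tree's `EchoTop.exists_witnessZoom_package`; taken BY NAME (gate lint dedup.landed).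

/-! ## §4 THE KILLS — ANGLE GENERATION (interval: Archimedes; one irrational turn: closed-subgroup dichotomy), point continuation, and the
tree's AXISYMMETRIC-WITH-SWIRL one-slice Liouville theorem BY NAME; the lagged-isometry kill by ENVELOPE TRANSPORT

Both kills run on `𝒦_M` and end in tree theorems quoted BY NAME:
* (KW) WHIRL pocket over a GENERATING angle set `Θ` (any frame, any apex) ⇒ `W ≡ 0`: extend the relation in the POINT (analytic slices,
  identity theorem on `ℝ³`), then in the ANGLE by GENERATION — the set of good angles of the transported slice `V = L⁻¹ W(−1, L· + b)` is an
  additive subgroup of `ℝ` containing `2π`, CLOSED (`V` is continuous), and contains `Θ`, hence is `ℝ` (`whirl_all_angles`): `V` is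
  AXISYMMETRIC (`IsAxisymmetric`, KNSS (1.5), swirl allowed) — and quote
  `NearExtremalTransiencePerFlow.FilamentSelection.eq_zero_of_conj_isAxisymmetric_oneSlice` (a member of `𝒦_M` one of whose slices is
  axisymmetric about ANY axis vanishes: eternal symmetry from one slice + the tree's absorbing-axis / swirl-extinction Liouville theorem
  `AxisymEndLiouville.AbsorbingAxisSwirlExtinction`, landed 2026-08-29).
* (KP) PRECESSION pocket for ONE `(L, d, θ)`, `θ > 0` ⇒ `W ≡ 0`: extend in the point; the field `V(s, y) = L W(s − θ, L⁻¹(y − b − d) + b)`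
  is a member of `𝒦_M` (time shift `comp_sub_right`, conjugation `isTypeIAncientMild_conj_affine`) with `V(−1) = W(−1)`, so `V = W` on the
  open past (ONE SLICE DETERMINES THE MEMBER: tree `LocalHelicityTubeDoorFrobeniusProfileRigidityHelicalSlice.eq_of_slice_eq`); iterating,
  `‖W(s, y)‖ ≤ M/√(−s + nθ)` for every `n` (`‖L v‖ = ‖v‖`), so `W ≡ 0`. -/

-- `centre_mem`: the line restates the tree's `IsTypeIAncientMild.comp_add_right`; taken BY NAME (gate lint dedup.landed).

-- `continuous_slice'`: the line restates the tree's `ScalingTop.continuous_slice'`; taken BY NAME (gate lint dedup.landed).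

/-! ### The rotation `R_θ` as a continuous linear map; the full turn; the orbit map `θ ↦ R_θ x` -/

-- `rotZ_add_vec'`: the line restates the tree's `ScrewBlowdown.rotZ_add_vec`; taken BY NAME (gate lint dedup.landed).

-- `rotZ_smul_vec'`: the line restates the tree's `rotZ_smul`; taken BY NAME (gate lint dedup.landed).

-- `rotZ_add_smul_eZ'`: the line restates the tree's `ScrewBlowdown.rotZ_add_smul_eZ`; taken BY NAME (gate lint dedup.landed).

-- `rotLin`: the line restates the tree's `ScrewTop.rotLin`; taken BY NAME (gate lint dedup.landed).

-- `rotCLM`: the line restates the tree's `ScrewTop.rotCLM`; taken BY NAME (gate lint dedup.landed).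

-- `continuous_rotZ`: the line restates the tree's `Literature.Analysis.FluidPDE.continuous_rotZ` (in the import closure and opened); taken BY NAME (gate lint dedup.landed).

-- `analyticAt_rotZ`: the line restates the tree's `ScrewTop.analyticAt_rotZ`; taken BY NAME (gate lint dedup.landed).

-- `analyticAt_linIso`: a statement-twin of the landed `PeepholeEchoDoorTwisted.analyticAt_linearIsometryEquiv` (route-cone module, NOT imported); not re-declared — its one-line proof term is inlined at the use sites.

-- `rotZ_neg_rotZ'`: the line restates the tree's `rotZ_neg_apply_rotZ`; taken BY NAME (gate lint dedup.landed).

-- `rotZ_two_pi'`: the line restates the tree's `RotationOrder.rotZ_two_pi`; taken BY NAME (gate lint dedup.landed).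

-- `continuous_rotZ_angle'`: the line restates the tree's `continuous_rotZ_angle`; taken BY NAME (gate lint dedup.landed).

/-! ### ANGLE GENERATION: an interval (Archimedes); one irrational turn (closed-subgroup dichotomy, tree lemma BY NAME) -/

/-- **An interval of good angles generates all angles** (LINE 41's `screw_all_angles` in predicate form; closedness is NOT used): a
property of angles stable under sums and negatives that holds on `[θ₁, θ₂]`, `θ₁ < θ₂`, holds everywhere — it holds on `[0, θ₂ − θ₁]`,
hence on every `[0, nδ]` (induction), hence on `ℝ` (Archimedes). -/
theorem forall_of_interval {P : ℝ → Prop} (hadd : ∀ φ ψ : ℝ, P φ → P ψ → P (φ + ψ)) (hneg : ∀ φ : ℝ, P φ → P (-φ))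
    {θ₁ θ₂ : ℝ} (h12 : θ₁ < θ₂) (hP : ∀ θ ∈ Icc θ₁ θ₂, P θ) : ∀ φ : ℝ, P φ := by
  set δ : ℝ := θ₂ - θ₁ with hδ
  have hδpos : 0 < δ := by rw [hδ]; exact sub_pos.2 h12
  have h0 : ∀ φ ∈ Icc 0 δ, P φ := by
    intro φ hφ
    have e : φ = (θ₁ + φ) + (-θ₁) := by ring
    rw [e]
    exact hadd _ _ (hP (θ₁ + φ) ⟨by linarith [hφ.1], by rw [hδ] at hφ; linarith [hφ.2]⟩) (hneg _ (hP θ₁ ⟨le_rfl, h12.le⟩))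
  have hn : ∀ n : ℕ, ∀ φ ∈ Icc 0 (((n : ℝ) + 1) * δ), P φ := by
    intro n
    induction n with
    | zero =>
      intro φ hφ
      exact h0 φ ⟨hφ.1, by simpa using hφ.2⟩
    | succ n ih =>
      intro φ hφ
      by_cases hle : φ ≤ ((n : ℝ) + 1) * δ
      · exact ih φ ⟨hφ.1, hle⟩
      · have e : φ = (φ - δ) + δ := by ring
        rw [e]
        push Not at hle
        have hnn : (0 : ℝ) ≤ (n : ℝ) * δ := mul_nonneg (Nat.cast_nonneg n) hδpos.le
        have h2 : φ ≤ ((n : ℝ) + 1 + 1) * δ := by have := hφ.2; push_cast at this; linarith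
        exact hadd _ _ (ih (φ - δ) ⟨by nlinarith, by nlinarith⟩) (h0 δ ⟨hδpos.le, le_rfl⟩)
  intro θ
  rcases le_or_gt 0 θ with hθ | hθ
  · obtain ⟨n, hnθ⟩ := exists_nat_ge (θ / δ)
    have hle : θ ≤ ((n : ℝ) + 1) * δ := by
      rw [div_le_iff₀ hδpos] at hnθ
      nlinarith
    exact hn n θ ⟨hθ, hle⟩
  · obtain ⟨n, hnθ⟩ := exists_nat_ge (-θ / δ)
    have hle : -θ ≤ ((n : ℝ) + 1) * δ := by
      rw [div_le_iff₀ hδpos] at hnθ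
      nlinarith
    have h' := hneg (-θ) (hn n (-θ) ⟨by linarith, hle⟩)
    simpa using h'

/-- A set containing a non-degenerate interval generates the angles. -/
theorem generatesAngles_of_Icc_subset {Θ : Set ℝ} {θ₁ θ₂ : ℝ} (h12 : θ₁ < θ₂) (hsub : Icc θ₁ θ₂ ⊆ Θ) : GeneratesAngles Θ :=
  fun _ _ hadd hneg _ _ hΘ => forall_of_interval hadd hneg h12 fun θ hθ => hΘ θ (hsub hθ)

/-- **(WX) A non-degenerate interval of angles generates.** -/
theorem generatesAngles_Icc {θ₁ θ₂ : ℝ} (h12 : θ₁ < θ₂) : GeneratesAngles (Icc θ₁ θ₂) :=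
  generatesAngles_of_Icc_subset h12 subset_rfl

-- `addSubgroup_eq_univ_of_irrational_angle`: the line restates the tree's `SymmetricScarExists.RdssSplit.NearIdentity.addSubgroup_eq_top_of_irrational_angle`; taken BY NAME (gate lint dedup.landed).

-- `forall_of_irrational_angle`: the line restates the tree's `SymmetricScarExists.RdssSplit.NearIdentity.forall_of_irrational_angle_stabiliser`; taken BY NAME (gate lint dedup.landed).

/-- A set containing ONE angle incommensurable with the full turn generates the angles (closed-subgroup dichotomy,
`SymmetricScarExists.RdssSplit.NearIdentity.forall_of_irrational_angle_stabiliser`). -/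
theorem generatesAngles_of_irrational_mem {Θ : Set ℝ} {θ₀ : ℝ} (hirr : Irrational (θ₀ / (2 * Real.pi))) (hmem : θ₀ ∈ Θ) :
    GeneratesAngles Θ :=
  fun _ h0 hadd hneg hcl h2π hΘ => SymmetricScarExists.RdssSplit.NearIdentity.forall_of_irrational_angle_stabiliser h0 hadd hneg hcl (hΘ θ₀ hmem) h2π hirr

/-- **(QX) ONE irrational turn generates.** -/
theorem generatesAngles_singleton {θ₀ : ℝ} (hirr : Irrational (θ₀ / (2 * Real.pi))) : GeneratesAngles ({θ₀} : Set ℝ) :=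
  generatesAngles_of_irrational_mem hirr rfl

/-- Generation is monotone in the angle set. -/
theorem GeneratesAngles.mono {Θ Θ' : Set ℝ} (h : GeneratesAngles Θ) (hsub : Θ ⊆ Θ') : GeneratesAngles Θ' :=
  fun P h0 hadd hneg hcl h2π hΘ' => h P h0 hadd hneg hcl h2π fun θ hθ => hΘ' θ (hsub hθ)

/-- **ANGLE CONTINUATION BY GENERATION.**  A CONTINUOUS map `V : ℝ³ → ℝ³` equivariant under the rotations `R_θ`, `θ ∈ Θ`, with `Θ`
generating, is equivariant under EVERY rotation about the axis — `V` is AXISYMMETRIC (with swirl allowed): the good angles form an additive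
subgroup (`rotZ_add`, `rotZ_zero`), closed (continuity of `V` and of the orbit maps), containing `2π` (`RotationOrder.rotZ_two_pi`). -/
theorem whirl_all_angles {V : E3 → E3} (hV : Continuous V) {Θ : Set ℝ} (hΘ : GeneratesAngles Θ)
    (h : ∀ θ ∈ Θ, ∀ y : E3, V (rotZ θ y) = rotZ θ (V y)) : ∀ (θ : ℝ) (y : E3), V (rotZ θ y) = rotZ θ (V y) := by
  refine hΘ (fun θ => ∀ y : E3, V (rotZ θ y) = rotZ θ (V y)) ?_ ?_ ?_ ?_ ?_ h
  · intro y
    rw [rotZ_zero, rotZ_zero]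
  · intro φ ψ hφ hψ y
    rw [rotZ_add, hφ, hψ, ← rotZ_add]
  · intro φ hφ y
    have e := hφ (rotZ (-φ) y)
    rw [← rotZ_add, add_neg_cancel, rotZ_zero] at e
    rw [e, rotZ_neg_apply_rotZ]
  · have hset : {φ : ℝ | ∀ y : E3, V (rotZ φ y) = rotZ φ (V y)} = ⋂ y : E3, {φ : ℝ | V (rotZ φ y) = rotZ φ (V y)} := by
      ext φ
      simp only [mem_setOf_eq, mem_iInter]
    rw [hset]
    exact isClosed_iInter fun y => isClosed_eq (hV.comp (continuous_rotZ_angle y)) (continuous_rotZ_angle (V y))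
  · intro y
    rw [RotationOrder.rotZ_two_pi, RotationOrder.rotZ_two_pi]

end Summit.NavierStokesRegularity.NavierStokesRegularity.Theorems.ScenarioCensus.WhirlTop

end
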